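import Literature.NumberTheory.LFunctions.LagariasDifferencedXiCharProofs
import Literature.NumberTheory.LFunctions.DirichletXiConjugation
import Literature.NumberTheory.LFunctions.DirichletLZeroCounting
import Literature.Analysis.Complex.FourierPolyaKiKimProofs
import Literature.Analysis.Complex.HadamardGenusZeroProofs
import Mathlib.Analysis.MeanInequalitiesPow
import HarnessLib

/-!
# The symmetric pair `Ξ_χ(s) = ξ(s, χ) ξ(s, χ̄)` of a primitive Dirichlet character and its Hadamard product (genus zero)

Topic `Literature/NumberTheory/LFunctions`, sub-namespace `DirichletTheta` (home of `dirichletXi`).  Everything here is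
PROVED; the two definitions are glue.  **RH-FREE and GRH-FREE** (no hypothesis on zeros).

For a primitive character `χ` mod `q` the completed `L`-function `ξ(s, χ) = (q/π)^{(s+a)/2} Γ((s+a)/2) L(s, χ)`
(`DirichletTheta.dirichletXi`, MV (10.19)) satisfies `ξ(s, χ) = ε(χ) ξ(1−s, χ̄)` (MV Cor. 10.8,
`dirichletXi_eq_rootNumber_mul_dirichletXi_inv_one_sub`) with `ε(χ)ε(χ̄) = 1` (`rootNumber_mul_rootNumber_inv`), so it is
NOT symmetric under `s ↦ 1 − s` by itself, but the PAIR

  `Ξ_χ(s) := ξ(s, χ)·ξ(s, χ̄)`   (`xiPair χ s`)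

is: `Ξ_χ(1 − s) = Ξ_χ(s)` (`xiPair_one_sub`), `conj Ξ_χ(s) = Ξ_χ(s̄)` (`conj_xiPair`), entire.  Hence
`z ↦ Ξ_χ(½ + z)` is EVEN, its even lift `G_χ(w) := Ξ_χ(½ + w^{1/2})` (`xiPairLift`) is entire with `G_χ(z²) = Ξ_χ(½ + z)`
(Ki–Kim's lemma `Literature.Analysis.Complex.KiKim.differentiable_comp_cpow_half`), of growth `‖G_χ(w)‖ ≤ C exp(‖w‖^{7/8})`
(order `¾` from `‖ξ(s,χ)‖ ≤ exp(K‖s‖^{3/2})`, `Lagarias2005Char.exists_norm_dirichletXi_le_exp`), and Hadamard's theorem in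
genus ZERO (`Literature.Analysis.Complex.hadamard_genus_zero_zeros`, PROVED) applies — at the base point `w₀ = 9/4`, where
`G_χ(9/4) = Ξ_χ(2) ≠ 0` unconditionally (the natural base point `w = 0`, i.e. `s = ½`, is unusable: `L(½, χ) = 0` is not
excluded).  Result (`exists_xiPair_hadamardSeq`): a summable sequence `b` with

  `Ξ_χ(½ + z) / Ξ_χ(2) = ∏ₙ (1 − bₙ (z² − 9/4))`   for all `z ∈ ℂ`,

the non-zero `bₙ` indexing the zeros `w = 9/4 + 1/bₙ = (ρ − ½)²` of `G_χ` with multiplicity.  This is the first third of the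
zero-sum identity `Σ_ρ m_χ(ρ) Re[1 − (1 − 1/ρ)ⁿ] = Re (1/(n−1)!) dⁿ/dsⁿ[s^{n−1} log ξ(s,χ)]_{s=1}` (Li 2004 Thm 2 / (2.3) in real
part; the tree's T-D2s `LiDirichletSplit`): the pair sees the zero multiset `{ρ} ⊎ {ρ̄}` and the Li functional of `log Ξ_χ`
is `2 Re` that of `log ξ_χ`.  The `ζ` twin of this file is `RiemannXiHadamardProduct.lean` (via de Bruijn's `H_t`).

## References
* H. L. Montgomery, R. C. Vaughan, *Multiplicative Number Theory I*, §10.1, Cor. 10.8. [MontgomeryVaughan2007]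
* J. B. Conway, *Functions of One Complex Variable I*, Ch. XI Thm. 3.4 (Hadamard). [Conway1978]
* X.-J. Li, Illinois J. Math. 48 (2004), Thm 2, (2.3). [Li2004]
-/

noncomputable section

open Complex Filter Topology Set Metric
open scoped ComplexConjugate

namespace Literature.NumberTheory.LFunctions

namespace DirichletTheta

variable {q : ℕ} [NeZero q] {χ : DirichletCharacter ℂ q}

/-! ### The pair `Ξ_χ` -/

/-- **The symmetric pair** `Ξ_χ(s) := ξ(s, χ)·ξ(s, χ̄)` of a Dirichlet character (`χ̄ = χ⁻¹`). [folklore] -/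
def xiPair (χ : DirichletCharacter ℂ q) (s : ℂ) : ℂ :=
  dirichletXi χ s * dirichletXi χ⁻¹ s

omit [NeZero q] in
/-- The inverse of a primitive character is primitive (same conductor). [folklore] -/
private theorem isPrimitive_inv' (hχ : χ.IsPrimitive) : χ⁻¹.IsPrimitive := by
  rw [DirichletCharacter.isPrimitive_def, DirichletCharacter.conductor_inv]
  exact hχ

/-- **`Ξ_χ(1 − s) = Ξ_χ(s)`** for a primitive `χ`: the functional equations of `ξ(·, χ)` and `ξ(·, χ̄)` (MV Cor. 10.8)
and `ε(χ) ε(χ̄) = 1`. [cite: MontgomeryVaughan2007, Cor 10.8] -/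
theorem xiPair_one_sub (hχ : χ.IsPrimitive) (s : ℂ) : xiPair χ (1 - s) = xiPair χ s := by
  have h1 := dirichletXi_eq_rootNumber_mul_dirichletXi_inv_one_sub hχ (1 - s)
  have h2 := dirichletXi_eq_rootNumber_mul_dirichletXi_inv_one_sub (isPrimitive_inv' hχ) (1 - s)
  rw [sub_sub_cancel] at h1 h2
  rw [inv_inv] at h2
  have hε := rootNumber_mul_rootNumber_inv hχ
  unfold xiPair
  rw [h1, h2]
  linear_combination (dirichletXi χ⁻¹ s * dirichletXi χ s) * hε

/-- **`conj Ξ_χ(s) = Ξ_χ(s̄)`** (`χ ≠ 1`): `conj ξ(s, χ) = ξ(s̄, χ̄)`. In particular `Ξ_χ` is real on the real axis and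
on the critical line. [cite: MontgomeryVaughan2007, §10.1 p. 334] -/
theorem conj_xiPair (h1 : χ ≠ 1) (s : ℂ) : conj (xiPair χ s) = xiPair χ (conj s) := by
  have h1' : χ⁻¹ ≠ 1 := inv_ne_one.mpr h1
  unfold xiPair
  rw [map_mul, conj_dirichletXi h1, conj_dirichletXi h1', inv_inv, mul_comm]

/-- `Ξ_χ` is entire (`χ ≠ 1`). [cite: MontgomeryVaughan2007, Cor 10.8] -/
theorem differentiable_xiPair (h1 : χ ≠ 1) : Differentiable ℂ (xiPair χ) :=
  (differentiable_dirichletXi h1).mul (differentiable_dirichletXi (inv_ne_one.mpr h1))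

/-- `Ξ_χ(2) ≠ 0` (`χ` primitive, `χ ≠ 1`): `ξ(·, χ)` and `ξ(·, χ̄)` have no zeros with `Re s ≥ 1`.
[cite: MontgomeryVaughan2007, Cor 10.8] -/
theorem xiPair_two_ne_zero (hχ : χ.IsPrimitive) (h1 : χ ≠ 1) : xiPair χ 2 ≠ 0 :=
  mul_ne_zero (dirichletXi_ne_zero_of_not_mem_strip hχ h1 (Or.inr (by norm_num)))
    (dirichletXi_ne_zero_of_not_mem_strip (isPrimitive_inv' hχ) (inv_ne_one.mpr h1) (Or.inr (by norm_num)))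

/-- `z ↦ Ξ_χ(½ + z)` is EVEN (primitive `χ`). [cite: MontgomeryVaughan2007, Cor 10.8] -/
theorem xiPair_half_add_neg (hχ : χ.IsPrimitive) (z : ℂ) : xiPair χ (1 / 2 + -z) = xiPair χ (1 / 2 + z) := by
  rw [← xiPair_one_sub hχ (1 / 2 + z)]
  congr 1
  ring

/-! ### The even lift `G_χ(w) = Ξ_χ(½ + w^{1/2})` -/

/-- **The even lift** `G_χ(w) := Ξ_χ(½ + w^{1/2})` (principal square root; an entire function of `w` with
`G_χ(z²) = Ξ_χ(½ + z)`). [folklore] -/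
def xiPairLift (χ : DirichletCharacter ℂ q) (w : ℂ) : ℂ :=
  xiPair χ (1 / 2 + w ^ ((2 : ℂ)⁻¹))

/-- `G_χ` is entire and `G_χ(z²) = Ξ_χ(½ + z)` (even entire functions are entire in `z²`; Ki–Kim's lemma).
[cite: KiKim2000, Theorem 4.3 (proof)] -/
private theorem differentiable_xiPairLift_and_sq (hχ : χ.IsPrimitive) (h1 : χ ≠ 1) :
    Differentiable ℂ (xiPairLift χ) ∧ ∀ z : ℂ, xiPairLift χ (z ^ 2) = xiPair χ (1 / 2 + z) := by
  have hf : Differentiable ℂ (fun z : ℂ ↦ xiPair χ (1 / 2 + z)) :=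
    (differentiable_xiPair h1).comp ((differentiable_const _).add differentiable_id)
  have heven : ∀ z : ℂ, (fun z : ℂ ↦ xiPair χ (1 / 2 + z)) (-z) = (fun z : ℂ ↦ xiPair χ (1 / 2 + z)) z :=
    fun z ↦ xiPair_half_add_neg hχ z
  exact Literature.Analysis.Complex.KiKim.differentiable_comp_cpow_half hf heven

/-- `G_χ` is entire: an even entire function is an entire function of `z²` (Ki–Kim 2000, proof of Thm 4.3,
«`g(x) = G(x²)`»; the tree's `KiKim.differentiable_comp_cpow_half`). [cite: KiKim2000, Theorem 4.3 (proof)] -/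
theorem differentiable_xiPairLift (hχ : χ.IsPrimitive) (h1 : χ ≠ 1) : Differentiable ℂ (xiPairLift χ) :=
  (differentiable_xiPairLift_and_sq hχ h1).1

/-- `G_χ(z²) = Ξ_χ(½ + z)` (the even function takes the same value at both square roots).
[cite: KiKim2000, Theorem 4.3 (proof)] -/
theorem xiPairLift_sq (hχ : χ.IsPrimitive) (h1 : χ ≠ 1) (z : ℂ) : xiPairLift χ (z ^ 2) = xiPair χ (1 / 2 + z) :=
  (differentiable_xiPairLift_and_sq hχ h1).2 z

/-- The base point: `G_χ(9/4) = Ξ_χ(2)` (`(3/2)² = 9/4`). [folklore] -/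
private theorem xiPairLift_nine_quarters (hχ : χ.IsPrimitive) (h1 : χ ≠ 1) : xiPairLift χ (9 / 4) = xiPair χ 2 := by
  have h := xiPairLift_sq hχ h1 (3 / 2)
  norm_num at h
  exact h

/-! ### Growth: order `¾ < 1` in the lifted variable -/

/-- Young-type splitting: `A r^{3/4} ≤ r^{7/8} + A⁷` for `A, r ≥ 0` (case `r^{1/8} ≥ A` / `< A`). [folklore] -/
private theorem mul_rpow_three_quarters_le {A r : ℝ} (hA : 0 ≤ A) (hr : 0 ≤ r) :
    A * r ^ (3 / 4 : ℝ) ≤ r ^ (7 / 8 : ℝ) + A ^ 7 := by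
  have h34 : 0 ≤ r ^ (3 / 4 : ℝ) := Real.rpow_nonneg hr _
  have h78 : 0 ≤ r ^ (7 / 8 : ℝ) := Real.rpow_nonneg hr _
  have hA7 : 0 ≤ A ^ 7 := pow_nonneg hA 7
  rcases le_or_gt A (r ^ (1 / 8 : ℝ)) with hle | hlt
  · -- `A r^{3/4} ≤ r^{1/8} r^{3/4} = r^{7/8}`
    have hmul : r ^ (1 / 8 : ℝ) * r ^ (3 / 4 : ℝ) = r ^ (7 / 8 : ℝ) := by
      rcases hr.eq_or_lt with h0 | hpos
      · subst h0; simp [Real.zero_rpow (by norm_num : (7 / 8 : ℝ) ≠ 0), Real.zero_rpow (by norm_num : (3 / 4 : ℝ) ≠ 0)]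
      · rw [← Real.rpow_add hpos]; norm_num
    calc A * r ^ (3 / 4 : ℝ) ≤ r ^ (1 / 8 : ℝ) * r ^ (3 / 4 : ℝ) := by gcongr
      _ = r ^ (7 / 8 : ℝ) := hmul
      _ ≤ r ^ (7 / 8 : ℝ) + A ^ 7 := le_add_of_nonneg_right hA7
  · -- `r^{3/4} = (r^{1/8})^6 < A^6`
    have h18 : 0 ≤ r ^ (1 / 8 : ℝ) := Real.rpow_nonneg hr _
    have hpow : r ^ (3 / 4 : ℝ) = (r ^ (1 / 8 : ℝ)) ^ (6 : ℕ) := by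
      rw [← Real.rpow_natCast, ← Real.rpow_mul hr]; norm_num
    have hlt6 : (r ^ (1 / 8 : ℝ)) ^ (6 : ℕ) ≤ A ^ 6 := pow_le_pow_left₀ h18 hlt.le 6
    calc A * r ^ (3 / 4 : ℝ) = A * (r ^ (1 / 8 : ℝ)) ^ (6 : ℕ) := by rw [hpow]
      _ ≤ A * A ^ 6 := by gcongr
      _ = A ^ 7 := by ring
      _ ≤ r ^ (7 / 8 : ℝ) + A ^ 7 := le_add_of_nonneg_left h78

/-- **Growth of the even lift**: `‖G_χ(w)‖ ≤ C·exp(‖w‖^{7/8})` for all `w` (primitive `χ ≠ 1`).  From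
`‖ξ(s,χ)‖, ‖ξ(s,χ̄)‖ ≤ exp(K‖s‖^{3/2})` for `‖s‖ ≥ 3` (MV Lemma 10.15 + Stirling, the tree's
`Lagarias2005Char.exists_norm_dirichletXi_le_exp`) with `s = ½ + w^{1/2}`, `‖s‖ ≤ 2‖w‖^{1/2}` for `‖w‖ ≥ 16`, so the exponent is
`≤ 3K‖w‖^{3/4} ≤ ‖w‖^{7/8} + (3K)⁷`; on `‖w‖ ≤ 16` continuity. [cite: MontgomeryVaughan2007, Lemma 10.15] -/
theorem exists_norm_xiPairLift_le (hχ : χ.IsPrimitive) (h1 : χ ≠ 1) :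
    ∃ C : ℝ, 0 ≤ C ∧ ∀ w : ℂ, ‖xiPairLift χ w‖ ≤ C * Real.exp (‖w‖ ^ (7 / 8 : ℝ)) := by
  obtain ⟨K₁, hK₁, hb₁⟩ := Lagarias2005Char.exists_norm_dirichletXi_le_exp hχ h1
  obtain ⟨K₂, hK₂, hb₂⟩ := Lagarias2005Char.exists_norm_dirichletXi_le_exp (isPrimitive_inv' hχ) (inv_ne_one.mpr h1)
  set A : ℝ := 3 * (K₁ + K₂) with hA
  have hA0 : 0 ≤ A := by rw [hA]; positivity
  -- compact part
  obtain ⟨M, hM⟩ := (isCompact_closedBall (0 : ℂ) 16).exists_bound_of_continuousOn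
    ((differentiable_xiPairLift hχ h1).continuous.continuousOn)
  set C : ℝ := max (max M 0) (Real.exp (A ^ 7)) with hC
  have hC0 : 0 ≤ C := le_trans (le_max_right M 0) (le_max_left _ _)
  refine ⟨C, hC0, fun w ↦ ?_⟩
  have hexp1 : 1 ≤ Real.exp (‖w‖ ^ (7 / 8 : ℝ)) := Real.one_le_exp (Real.rpow_nonneg (norm_nonneg w) _)
  rcases le_or_gt ‖w‖ 16 with hle | hgt
  · -- `‖w‖ ≤ 16`
    have h := hM w (by simpa using hle)
    calc ‖xiPairLift χ w‖ ≤ M := h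
      _ ≤ max M 0 := le_max_left _ _
      _ ≤ C := le_max_left _ _
      _ ≤ C * Real.exp (‖w‖ ^ (7 / 8 : ℝ)) := le_mul_of_one_le_right hC0 hexp1
  · -- `‖w‖ > 16`: `s = ½ + w^{1/2}`, `3 ≤ ‖s‖ ≤ 2‖w‖^{1/2}`
    set r : ℝ := ‖w‖ with hr
    have hr0 : 0 < r := by linarith
    have hroot : ‖w ^ ((2 : ℂ)⁻¹)‖ = r ^ ((2 : ℝ)⁻¹) := Literature.Analysis.Complex.KiKim.norm_cpow_half w
    have hroot4 : 4 ≤ r ^ ((2 : ℝ)⁻¹) := by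
      have h16 : (16 : ℝ) ^ ((2 : ℝ)⁻¹) = 4 := by
        rw [show (16 : ℝ) = 4 ^ (2 : ℝ) by norm_num, ← Real.rpow_mul (by norm_num)]; norm_num
      rw [← h16]
      exact Real.rpow_le_rpow (by norm_num) hgt.le (by norm_num)
    set s : ℂ := 1 / 2 + w ^ ((2 : ℂ)⁻¹) with hs
    have hs_le : ‖s‖ ≤ 2 * r ^ ((2 : ℝ)⁻¹) := by
      calc ‖s‖ ≤ ‖(1 / 2 : ℂ)‖ + ‖w ^ ((2 : ℂ)⁻¹)‖ := norm_add_le _ _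
        _ = 1 / 2 + r ^ ((2 : ℝ)⁻¹) := by rw [hroot]; norm_num
        _ ≤ 2 * r ^ ((2 : ℝ)⁻¹) := by linarith
    have hs_ge : 3 ≤ ‖s‖ := by
      have h := norm_sub_le_norm_add (w ^ ((2 : ℂ)⁻¹)) (1 / 2 : ℂ)
      have e : ‖(1 / 2 : ℂ)‖ = 1 / 2 := by norm_num
      rw [add_comm, ← hs, hroot, e] at h
      linarith
    have hxi1 := hb₁ s hs_ge
    have hxi2 := hb₂ s hs_ge
    have hs0 : 0 ≤ ‖s‖ := norm_nonneg _
    -- `‖s‖^{3/2} ≤ (2 r^{1/2})^{3/2} ≤ 3 r^{3/4}` (as `2^{3/2} ≤ 3`)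
    have hs32 : ‖s‖ ^ (3 / 2 : ℝ) ≤ 3 * r ^ (3 / 4 : ℝ) := by
      have h1' : ‖s‖ ^ (3 / 2 : ℝ) ≤ (2 * r ^ ((2 : ℝ)⁻¹)) ^ (3 / 2 : ℝ) :=
        Real.rpow_le_rpow hs0 hs_le (by norm_num)
      have h2' : (2 * r ^ ((2 : ℝ)⁻¹)) ^ (3 / 2 : ℝ) = (2 : ℝ) ^ (3 / 2 : ℝ) * r ^ (3 / 4 : ℝ) := by
        rw [Real.mul_rpow (by norm_num) (Real.rpow_nonneg hr0.le _), ← Real.rpow_mul hr0.le]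
        norm_num
      have h3' : (2 : ℝ) ^ (3 / 2 : ℝ) ≤ 3 := by
        have h9 : ((2 : ℝ) ^ (3 / 2 : ℝ)) ^ (2 : ℕ) = 8 := by
          rw [← Real.rpow_natCast, ← Real.rpow_mul (by norm_num)]; norm_num
        nlinarith [Real.rpow_nonneg (by norm_num : (0 : ℝ) ≤ 2) (3 / 2 : ℝ)]
      calc ‖s‖ ^ (3 / 2 : ℝ) ≤ (2 : ℝ) ^ (3 / 2 : ℝ) * r ^ (3 / 4 : ℝ) := h1'.trans h2'.le
        _ ≤ 3 * r ^ (3 / 4 : ℝ) := by gcongr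
    have hprod : ‖xiPairLift χ w‖ ≤ Real.exp (A * r ^ (3 / 4 : ℝ)) := by
      have e : xiPairLift χ w = dirichletXi χ s * dirichletXi χ⁻¹ s := rfl
      rw [e, norm_mul]
      calc ‖dirichletXi χ s‖ * ‖dirichletXi χ⁻¹ s‖
          ≤ Real.exp (K₁ * ‖s‖ ^ (3 / 2 : ℝ)) * Real.exp (K₂ * ‖s‖ ^ (3 / 2 : ℝ)) :=
            mul_le_mul hxi1 hxi2 (norm_nonneg _) (Real.exp_nonneg _)
        _ = Real.exp ((K₁ + K₂) * ‖s‖ ^ (3 / 2 : ℝ)) := by rw [← Real.exp_add]; ring_nf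
        _ ≤ Real.exp (A * r ^ (3 / 4 : ℝ)) := by
            refine Real.exp_le_exp.2 ?_
            calc (K₁ + K₂) * ‖s‖ ^ (3 / 2 : ℝ) ≤ (K₁ + K₂) * (3 * r ^ (3 / 4 : ℝ)) := by
                  exact mul_le_mul_of_nonneg_left hs32 (by positivity)
              _ = A * r ^ (3 / 4 : ℝ) := by rw [hA]; ring
    have hyoung := mul_rpow_three_quarters_le hA0 hr0.le
    calc ‖xiPairLift χ w‖ ≤ Real.exp (A * r ^ (3 / 4 : ℝ)) := hprod
      _ ≤ Real.exp (r ^ (7 / 8 : ℝ) + A ^ 7) := Real.exp_le_exp.2 hyoung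
      _ = Real.exp (A ^ 7) * Real.exp (r ^ (7 / 8 : ℝ)) := by rw [Real.exp_add, mul_comm]
      _ ≤ C * Real.exp (r ^ (7 / 8 : ℝ)) := by
          gcongr
          exact le_max_right _ _

/-! ### Hadamard's theorem in genus zero for `G_χ` at the base point `9/4` -/

/-- **Hadamard product of the pair `Ξ_χ`** (primitive `χ ≠ 1`).  There is a sequence `b : ℕ → ℂ` with `Σ ‖bₙ‖ < ∞` such that

  `Ξ_χ(½ + z) / Ξ_χ(2) = ∏ₙ (1 − bₙ (z² − 9/4))`   for every `z ∈ ℂ`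

(unconditionally convergent), where the non-zero `bₙ` are the inverses of the zeros `w` of `G_χ(· + 9/4)` — i.e.
`9/4 + 1/bₙ = (ρ − ½)²` for the zeros `ρ` of `ξ(·,χ)ξ(·,χ̄)` — repeated with multiplicity: for `a ≠ 0`,
`#{n : bₙ = a⁻¹} = ord_{w=a} G_χ(w + 9/4)`.  Hadamard's factorisation in genus zero (Conway XI.3.4; the tree's PROVED
`hadamard_genus_zero_zeros`) applied to the entire function `w ↦ G_χ(w + 9/4)` of order `≤ 7/8 < 1`, non-zero at `w = 0`
(`G_χ(9/4) = Ξ_χ(2) ≠ 0`; the centre `s = ½` itself is avoided because `L(½, χ) = 0` is not excluded).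
[cite: Conway1978, Ch. XI Thm. 3.4] -/
theorem exists_xiPair_hadamardSeq (hχ : χ.IsPrimitive) (h1 : χ ≠ 1) :
    ∃ b : ℕ → ℂ, Summable (fun n ↦ ‖b n‖) ∧
      (∀ n, b n ≠ 0 → xiPairLift χ ((b n)⁻¹ + 9 / 4) = 0) ∧
      (∀ a : ℂ, a ≠ 0 → {n : ℕ | b n = a⁻¹}.ncard = analyticOrderNatAt (fun w ↦ xiPairLift χ (w + 9 / 4)) a) ∧
      ∀ z : ℂ, HasProd (fun n ↦ 1 - b n * (z ^ 2 - 9 / 4)) (xiPair χ (1 / 2 + z) / xiPair χ 2) := by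
  obtain ⟨C, hC0, hC⟩ := exists_norm_xiPairLift_le hχ h1
  set f : ℂ → ℂ := fun w ↦ xiPairLift χ (w + 9 / 4) with hf
  have hfd : Differentiable ℂ f := (differentiable_xiPairLift hχ h1).comp (differentiable_id.add_const _)
  -- growth of the shifted function: `‖w + 9/4‖^{7/8} ≤ ‖w‖^{7/8} + (9/4)^{7/8}`
  set C' : ℝ := C * Real.exp ((9 / 4 : ℝ) ^ (7 / 8 : ℝ)) with hC'
  have hgrowth : ∀ w : ℂ, ‖f w‖ ≤ C' * Real.exp (‖w‖ ^ (7 / 8 : ℝ)) := by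
    intro w
    have h := hC (w + 9 / 4)
    have hn : ‖w + 9 / 4‖ ≤ ‖w‖ + 9 / 4 := by
      calc ‖w + 9 / 4‖ ≤ ‖w‖ + ‖(9 / 4 : ℂ)‖ := norm_add_le _ _
        _ = ‖w‖ + 9 / 4 := by norm_num
    have hpow : ‖w + 9 / 4‖ ^ (7 / 8 : ℝ) ≤ ‖w‖ ^ (7 / 8 : ℝ) + (9 / 4 : ℝ) ^ (7 / 8 : ℝ) := by
      calc ‖w + 9 / 4‖ ^ (7 / 8 : ℝ) ≤ (‖w‖ + 9 / 4) ^ (7 / 8 : ℝ) :=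
            Real.rpow_le_rpow (norm_nonneg _) hn (by norm_num)
        _ ≤ ‖w‖ ^ (7 / 8 : ℝ) + (9 / 4 : ℝ) ^ (7 / 8 : ℝ) :=
            Real.rpow_add_le_add_rpow (norm_nonneg _) (by norm_num) (by norm_num) (by norm_num)
    calc ‖f w‖ = ‖xiPairLift χ (w + 9 / 4)‖ := rfl
      _ ≤ C * Real.exp (‖w + 9 / 4‖ ^ (7 / 8 : ℝ)) := h
      _ ≤ C * Real.exp (‖w‖ ^ (7 / 8 : ℝ) + (9 / 4 : ℝ) ^ (7 / 8 : ℝ)) := by gcongr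
      _ = C' * Real.exp (‖w‖ ^ (7 / 8 : ℝ)) := by rw [hC', Real.exp_add]; ring
  have hf0 : f 0 ≠ 0 := by
    show xiPairLift χ (0 + 9 / 4) ≠ 0
    rw [zero_add, xiPairLift_nine_quarters hχ h1]
    exact xiPair_two_ne_zero hχ h1
  obtain ⟨b, hbs, hzero, hmult, hprod⟩ :=
    Literature.Analysis.Complex.hadamard_genus_zero_zeros f (7 / 8) C' hfd (by norm_num) hgrowth hf0
  refine ⟨b, hbs, fun n hn ↦ hzero n hn, fun a ha ↦ hmult a ha, fun z ↦ ?_⟩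
  have h := hprod (z ^ 2 - 9 / 4)
  have e1 : f (z ^ 2 - 9 / 4) = xiPair χ (1 / 2 + z) := by
    show xiPairLift χ (z ^ 2 - 9 / 4 + 9 / 4) = xiPair χ (1 / 2 + z)
    rw [sub_add_cancel, xiPairLift_sq hχ h1]
  have e0 : f 0 = xiPair χ 2 := by
    show xiPairLift χ (0 + 9 / 4) = xiPair χ 2
    rw [zero_add, xiPairLift_nine_quarters hχ h1]
  rw [e1, e0] at h
  exact h

end DirichletTheta

end Literature.NumberTheory.LFunctions

end
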